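import Summits.QuantumFields.YangMills.Theorems.ConvexGribovBodyNonSimplyConnectedLatticeGapChainChessboard
import Summits.QuantumFields.YangMills.Theorems.ConvexGribovBodyNonSimplyConnectedLatticeGapStubCorrPullbackCover
import HarnessLib

/-!
# Crux `NonSimplyConnectedLatticeGap` (stmt-QuantumFields-16405), line `twist-equipartition-blindness`:
# the bad event of the sector interface is exponentially rare (Peierls ON THE TORUS) — helper toward stub STRUCT

Write `μ̃ = wilsonMeasure (r.ρ ∘ π) β` for the Wilson state of the cover theory `(H, r ∘ π)` on `(ℤ/(2S+1))⁴` and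
`μ = wilsonMeasure r.ρ β` for the `(G, r)` state. Clause X0 of the sector interface of the skeleton
`Cruxes/NonSimplyConnectedLatticeGap/Lines/twist_equipartition_blindness.lean` pins the unlabelled set of the labelling to
the explicit BAD EVENT `Bad_{a,S}(V)`: `S < 64`, or a chain `ch₀ … ch_k` of torus plaquettes, each with blind action
`r.N − Re tr (r ∘ π)(V_{ch_i}) ≥ a`, consecutive base points within torus sup-distance `3` (`max_j |(x_j − y_j).valMinAbs|`),
end-to-end distance `≥ S/16`.

* `torusBadEventRare_base`: every compact `G`, faithful `r`, `a > 0`: there is `β_c` such that for `β ≥ β_c` there are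
  `c > 0`, `C ≥ 0` with `μ(Bad_{a,S}) ≤ C e^{−cS}` for all `S`;
* `torusBadEventRare`: the same for `μ̃` in the cover context of the line (binder block of STRUCT, event of X0 verbatim):
  the event depends on `V` only through `π ∘ V` (`(r ∘ π)(V_p) = r((π ∘ V)_p)`, `corrPullback_plaquetteHolonomy_comp`) and
  `(π ∘ ·)_* μ̃ = μ` (`map_wilsonMeasure_comp_of_surjective`).

Proof of the base bound (Peierls on the torus; the combinatorics is adapted from the private ℤ⁴ lemmas of the landed
`stub_longBadChainsRare_of_chessboard`): (1) a bad chain contains an INJECTIVE bad chain with the same endpoints and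
steps `≤ 3` (`torus_exists_injective_chain`); steps `≤ 3` force end-to-end distance `≤ 3K`, so `K ≥ S/48`; (2) the chains
of `K + 1` torus plaquettes with steps `≤ 3` number `≤ 6(2S+1)⁴ · 14406^K` (`14406 = 7⁴ · 6`, `torus_exists_chainFinset`);
(3) for an injective chain the image has `K + 1` plaquettes, so large-field sparseness on the odd torus
(`largeFieldSparse_explicit`: `μ(all of X bad) ≤ e^{−c₀β|X|}`, `β ≥ b₀`, `S ≥ 1`) bounds it by `q^{K+1}`, `q = e^{−c₀β}`;
(4) for `β ≥ β_c = max b₀ ((2 + log 14406)/c₀)`, `14406 q ≤ e^{−2}`; union bound and geometric series give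
`μ(Bad) ≤ 12 q (2S+1)⁴ e^{−2⌊S/48⌋} ≤ 12 q · 24 · 96⁴ · e² · e^{−S/48}`; the disjunct `S < 64` is absorbed into `C`.

References: R. Peierls, Proc. Camb. Phil. Soc. 32 (1936) 477; E. Seiler, LNP 159 (1982), Ch. 3.
-/

set_option autoImplicit false

noncomputable section

open MeasureTheory
open Literature.MathematicalPhysics.QuantumFieldTheory

namespace Summit.QuantumFields.YangMills.Theorems.NonSimplyConnectedLatticeGap

/-- `dist(x, y) ≤ n` in the torus sup-distance iff every coordinate is within `n`. -/
private theorem torus_tsup_le_iff {L : ℕ} {x y : Site 4 L} {n : ℕ} :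
    (Finset.univ.sup fun j : Fin 4 => ((x j - y j).valMinAbs).natAbs) ≤ n ↔ ∀ j, ((x j - y j).valMinAbs).natAbs ≤ n := by
  simp [Finset.sup_le_iff]

/-- Triangle inequality for the torus sup-distance `max_j |(x_j − y_j).valMinAbs|`. -/
private theorem torus_tsup_triangle {L : ℕ} (x y z : Site 4 L) :
    (Finset.univ.sup fun j : Fin 4 => ((x j - z j).valMinAbs).natAbs) ≤
      (Finset.univ.sup fun j : Fin 4 => ((x j - y j).valMinAbs).natAbs) +
        (Finset.univ.sup fun j : Fin 4 => ((y j - z j).valMinAbs).natAbs) := by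
  rw [torus_tsup_le_iff]
  intro j
  rw [show x j - z j = (x j - y j) + (y j - z j) by abel]
  exact ((ZMod.natAbs_valMinAbs_add_le _ _).trans (Int.natAbs_add_le _ _)).trans (add_le_add
    (Finset.le_sup (f := fun j : Fin 4 => ((x j - y j).valMinAbs).natAbs) (Finset.mem_univ j))
    (Finset.le_sup (f := fun j : Fin 4 => ((y j - z j).valMinAbs).natAbs) (Finset.mem_univ j)))

/-- **A bad chain contains an injective bad chain.** If `c₀, …, c_k` satisfy `Q`, have torus steps `≤ 3` and end-to-end
distance `≥ D`, then some INJECTIVE chain satisfies `Q`, has steps `≤ 3` and length `K` with `D ≤ 3K` (a chain of minimal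
length with end-to-end distance `≥ D` has no repetition: it could be spliced out). -/
private theorem torus_exists_injective_chain {L : ℕ} {Q : Plaquette 4 L → Prop} {D k : ℕ} (c : Fin (k + 1) → Plaquette 4 L)
    (hQ : ∀ i, Q (c i))
    (hstep : ∀ i : Fin k, (Finset.univ.sup fun j : Fin 4 => (((c i.castSucc).1 j - (c i.succ).1 j).valMinAbs).natAbs) ≤ 3)
    (hlong : D ≤ Finset.univ.sup fun j : Fin 4 => (((c 0).1 j - (c (Fin.last k)).1 j).valMinAbs).natAbs) :
    ∃ (K : ℕ) (c' : Fin (K + 1) → Plaquette 4 L), Function.Injective c' ∧ (∀ i, Q (c' i)) ∧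
      (∀ i : Fin K, (Finset.univ.sup fun j : Fin 4 => (((c' i.castSucc).1 j - (c' i.succ).1 j).valMinAbs).natAbs) ≤ 3) ∧
      D ≤ 3 * K := by
  classical
  -- `ℕ`-indexed presentations of chains of length `K + 1`
  let P : ℕ → (ℕ → Plaquette 4 L) → Prop := fun K g => (∀ n ≤ K, Q (g n)) ∧
    (∀ n < K, (Finset.univ.sup fun j : Fin 4 => (((g n).1 j - (g (n + 1)).1 j).valMinAbs).natAbs) ≤ 3) ∧
      D ≤ Finset.univ.sup fun j : Fin 4 => (((g 0).1 j - (g K).1 j).valMinAbs).natAbs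
  -- splicing out a loop `g i = g j`, `i < j ≤ K`
  have hsplice : ∀ (K : ℕ) (g : ℕ → Plaquette 4 L), P K g → ∀ i j : ℕ, i < j → j ≤ K → g i = g j →
      P (K - (j - i)) (fun n => if n ≤ i then g n else g (n + (j - i))) := by
    rintro K g ⟨h1, h2, h3⟩ i j hij hj he
    refine ⟨fun n hn => ?_, fun n hn => ?_, ?_⟩
    · dsimp only
      split_ifs with c1
      · exact h1 n (by omega)
      · exact h1 _ (by omega)
    · dsimp only
      by_cases c1 : n + 1 ≤ i
      · rw [if_pos (Nat.le_of_succ_le c1), if_pos c1]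
        exact h2 n (by omega)
      by_cases c0 : n ≤ i
      · rw [if_pos c0, if_neg c1, show g n = g j by rw [show n = i by omega, he], show n + 1 + (j - i) = j + 1 by omega]
        exact h2 j (by omega)
      · rw [if_neg c0, if_neg c1, show n + 1 + (j - i) = n + (j - i) + 1 by omega]
        exact h2 _ (by omega)
    · dsimp only
      rw [if_pos (Nat.zero_le i)]
      split_ifs with c1
      · rw [show K - (j - i) = i by omega, he, show j = K by omega]
        exact h3
      · rw [Nat.sub_add_cancel (by omega : j - i ≤ K)]
        exact h3
  -- the given chain, `ℕ`-indexed
  let f : ℕ → Plaquette 4 L := fun n => if h : n ≤ k then c ⟨n, Nat.lt_succ_of_le h⟩ else c 0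
  have hf : P k f := by
    refine ⟨fun n hn => ?_, fun n hn => ?_, ?_⟩
    · simp only [f, dif_pos hn]
      exact hQ _
    · simp only [f, dif_pos (Nat.le_of_lt hn), dif_pos (Nat.succ_le_of_lt hn)]
      exact hstep ⟨n, hn⟩
    · simp only [f, dif_pos (Nat.zero_le k), dif_pos (le_refl k)]
      exact hlong
  have hex : ∃ K, ∃ g : ℕ → Plaquette 4 L, P K g := ⟨k, f, hf⟩
  obtain ⟨g, hg⟩ := Nat.find_spec hex
  -- end-to-end distance of a chain with steps `≤ 3`
  have hdist : ∀ n ≤ Nat.find hex, (Finset.univ.sup fun j : Fin 4 => (((g 0).1 j - (g n).1 j).valMinAbs).natAbs) ≤ 3 * n := by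
    intro n
    induction n with
    | zero => exact fun _ => by simp [sub_self, ZMod.valMinAbs_zero]
    | succ n ih =>
      intro hn
      have e1 := ih (Nat.le_of_succ_le hn)
      have e2 := hg.2.1 n (Nat.lt_of_succ_le hn)
      have e3 := torus_tsup_triangle (g 0).1 (g n).1 (g (n + 1)).1
      omega
  refine ⟨Nat.find hex, fun i => g i, ?_, fun i => hg.1 i (Nat.le_of_lt_succ i.2), fun i => hg.2.1 i i.2,
    hg.2.2.trans (hdist _ le_rfl)⟩
  -- minimality ⇒ injectivity
  intro s t hst
  by_contra hne
  have hs := s.2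
  have ht := t.2
  rcases Nat.lt_or_gt_of_ne (fun e => hne (Fin.ext e)) with hlt | hlt
  · exact Nat.find_min hex (show Nat.find hex - (t - s) < Nat.find hex by omega) ⟨_, hsplice _ g hg s t hlt (by omega) hst⟩
  · exact Nat.find_min hex (show Nat.find hex - (s - t) < Nat.find hex by omega)
      ⟨_, hsplice _ g hg t s hlt (by omega) hst.symm⟩

/-- The step alphabet: the torus plaquettes `(v, o)` with `max_j |v_j.valMinAbs| ≤ 3` lie in a Finset of cardinality
`≤ 7⁴ · 6 = 14406` (image of the box `[−3, 3]⁴ ⊆ ℤ⁴`, times the orientations). -/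
private theorem torus_exists_stepFinset (L : ℕ) : ∃ D : Finset (Plaquette 4 L), D.card ≤ 14406 ∧
    ∀ (x y : Site 4 L) (o : {p : Fin 4 × Fin 4 // p.1 < p.2}),
      (Finset.univ.sup fun j : Fin 4 => ((x j - y j).valMinAbs).natAbs) ≤ 3 → (x - y, o) ∈ D := by
  classical
  -- the box `[−3, 3]⁴ ⊆ ℤ⁴` (kept abstract, so that membership is never evaluated)
  obtain ⟨B, hBcard, hBmem⟩ : ∃ B : Finset (Fin 4 → ℤ), B.card = 2401 ∧ ∀ v : Fin 4 → ℤ, (∀ j, -3 ≤ v j ∧ v j ≤ 3) → v ∈ B := by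
    refine ⟨Fintype.piFinset fun _ : Fin 4 => Finset.Icc (-3 : ℤ) 3, ?_, fun v hv =>
      Fintype.mem_piFinset.2 fun j => Finset.mem_Icc.2 (hv j)⟩
    rw [Fintype.card_piFinset, Finset.prod_const, Finset.card_univ, Fintype.card_fin, Int.card_Icc]
    decide
  have h6 : Fintype.card {p : Fin 4 × Fin 4 // p.1 < p.2} = 6 := by decide
  refine ⟨(B.image fun v : Fin 4 → ℤ => fun j => ((v j : ℤ) : ZMod L)) ×ˢ Finset.univ, ?_, fun x y o hx => ?_⟩
  · rw [Finset.card_product, Finset.card_univ, h6]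
    have hc := Finset.card_image_le (s := B) (f := fun v : Fin 4 → ℤ => fun j => ((v j : ℤ) : ZMod L))
    omega
  · refine Finset.mem_product.2 ⟨Finset.mem_image.2 ⟨fun j => (x j - y j).valMinAbs, hBmem _ fun j => ?_,
      funext fun j => ?_⟩, Finset.mem_univ _⟩
    · have h := (torus_tsup_le_iff.1 hx) j
      omega
    · simp only [Pi.sub_apply, ZMod.coe_valMinAbs]

/-- **Peierls counting on the torus.** The chains of `k + 1` torus plaquettes starting in `B` with consecutive base points
within torus sup-distance `3` lie in a Finset of cardinality `≤ |B| · 14406^k` (append one step at a time, `Fin.snoc`). -/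
private theorem torus_exists_chainFinset (L : ℕ) (B : Finset (Plaquette 4 L)) : ∀ k : ℕ,
    ∃ T : Finset (Fin (k + 1) → Plaquette 4 L), T.card ≤ B.card * 14406 ^ k ∧ ∀ c : Fin (k + 1) → Plaquette 4 L, c 0 ∈ B →
      (∀ i : Fin k, (Finset.univ.sup fun j : Fin 4 => (((c i.castSucc).1 j - (c i.succ).1 j).valMinAbs).natAbs) ≤ 3) → c ∈ T
  | 0 => by
    classical
    refine ⟨B.image fun p _ => p, ?_, fun c h0 _ => ?_⟩
    · rw [pow_zero, mul_one]
      exact Finset.card_image_le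
    · exact Finset.mem_image.2 ⟨c 0, h0, funext fun i => by rw [Fin.fin_one_eq_zero i]⟩
  | k + 1 => by
    classical
    obtain ⟨T, hT, hmem⟩ := torus_exists_chainFinset L B k
    obtain ⟨D, hD, hDmem⟩ := torus_exists_stepFinset L
    refine ⟨(T ×ˢ D).image fun cv => Fin.snoc cv.1 ((cv.1 (Fin.last k)).1 - cv.2.1, cv.2.2), ?_, fun c h0 hstep => ?_⟩
    · calc _ ≤ (T ×ˢ D).card := Finset.card_image_le
        _ = T.card * D.card := by rw [Finset.card_product]
        _ ≤ B.card * 14406 ^ k * 14406 := Nat.mul_le_mul hT hD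
        _ = B.card * 14406 ^ (k + 1) := by ring
    · have hinit : Fin.init c ∈ T :=
        hmem (Fin.init c) (by rw [show Fin.init c 0 = c 0 from congrArg c Fin.castSucc_zero]; exact h0) fun i => by
          have h := hstep i.castSucc
          rwa [Fin.succ_castSucc] at h
      have hlast : (Finset.univ.sup fun j : Fin 4 =>
          (((c (Fin.last k).castSucc).1 j - (c (Fin.last (k + 1))).1 j).valMinAbs).natAbs) ≤ 3 := by
        have h := hstep (Fin.last k)
        rwa [Fin.succ_last] at h
      refine Finset.mem_image.2 ⟨(Fin.init c, ((c (Fin.last k).castSucc).1 - (c (Fin.last (k + 1))).1,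
        (c (Fin.last (k + 1))).2)), Finset.mem_product.2 ⟨hinit, hDmem _ _ _ hlast⟩, ?_⟩
      show Fin.snoc (Fin.init c) ((Fin.init c (Fin.last k)).1 -
          ((c (Fin.last k).castSucc).1 - (c (Fin.last (k + 1))).1), (c (Fin.last (k + 1))).2) = c
      rw [show Fin.init c (Fin.last k) = c (Fin.last k).castSucc from rfl, sub_sub_cancel, Prod.mk.eta]
      exact Fin.snoc_init_self c

/-- Polynomial × geometric ≤ exponential: `(2S+1)⁴ e^{−2k₀} ≤ 24 · 96⁴ · e² · e^{−S/48}` when `S ≤ 48 k₀ + 47`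
(from `y⁴ / 4! ≤ e^y` at `y = (2S+1)/96`). -/
private theorem torus_poly_geom_le_exp (S k₀ : ℕ) (hk : S ≤ 48 * k₀ + 47) :
    ((2 : ℝ) * S + 1) ^ 4 * Real.exp (-(2 * (k₀ : ℝ))) ≤ 24 * 96 ^ 4 * Real.exp 2 * Real.exp (-(1 / 48 * (S : ℝ))) := by
  have h1 : ((2 : ℝ) * S + 1) ^ 4 ≤ 24 * 96 ^ 4 * Real.exp ((2 * S + 1) / 96) := by
    have h := Real.pow_div_factorial_le_exp ((2 * (S : ℝ) + 1) / 96) (by positivity) 4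
    rw [show ((Nat.factorial 4 : ℕ) : ℝ) = 24 by norm_num [Nat.factorial], div_pow, div_div, div_le_iff₀ (by positivity)] at h
    linarith
  have h2 : Real.exp (-(2 * (k₀ : ℝ))) ≤ Real.exp (47 / 24 - (S : ℝ) / 24) := by
    refine Real.exp_le_exp.2 ?_
    have : (S : ℝ) ≤ 48 * k₀ + 47 := by exact_mod_cast hk
    linarith
  have h3 : Real.exp ((2 * S + 1) / 96) * Real.exp (47 / 24 - (S : ℝ) / 24) =
      Real.exp (189 / 96) * Real.exp (-(1 / 48 * (S : ℝ))) := by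
    rw [← Real.exp_add, ← Real.exp_add]
    congr 1
    ring
  calc ((2 : ℝ) * S + 1) ^ 4 * Real.exp (-(2 * (k₀ : ℝ)))
      ≤ (24 * 96 ^ 4 * Real.exp ((2 * S + 1) / 96)) * Real.exp (47 / 24 - (S : ℝ) / 24) :=
        mul_le_mul h1 h2 (Real.exp_pos _).le (by positivity)
    _ = 24 * 96 ^ 4 * (Real.exp (189 / 96) * Real.exp (-(1 / 48 * (S : ℝ)))) := by rw [mul_assoc, h3]
    _ ≤ 24 * 96 ^ 4 * (Real.exp 2 * Real.exp (-(1 / 48 * (S : ℝ)))) := by gcongr; norm_num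
    _ = 24 * 96 ^ 4 * Real.exp 2 * Real.exp (-(1 / 48 * (S : ℝ))) := by ring

/-- **The bad event of the sector interface is exponentially rare in the `(G, r)` torus Wilson theory at large `β`** (every
compact `G`, faithful continuous unitary `r`, threshold `a > 0`): there is `β_c` such that for every `β ≥ β_c` there are
`c > 0`, `C ≥ 0` with `μ_{β,2S+1}(S < 64 ∨ ∃ chain of a-bad plaquettes, torus steps ≤ 3, extent ≥ S/16) ≤ C e^{−cS}` for all
`S` (Peierls on the torus over `largeFieldSparse_explicit`; rate `c = 1/48`). -/
theorem torusBadEventRare_base (G : Type) [Group G] [TopologicalSpace G] [IsTopologicalGroup G] [CompactSpace G]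
    [MeasurableSpace G] [BorelSpace G] (r : Literature.MathematicalPhysics.QuantumFieldTheory.LatticeRep G) (a : ℝ) (ha : 0 < a) :
    ∃ β_c : ℝ, ∀ β : ℝ, β_c ≤ β → ∃ c : ℝ, 0 < c ∧ ∃ C : ℝ, 0 ≤ C ∧ ∀ S : ℕ,
      (Literature.MathematicalPhysics.QuantumFieldTheory.wilsonMeasure r.ρ β : MeasureTheory.Measure
        (Literature.MathematicalPhysics.QuantumFieldTheory.GaugeConfig 4 (2 * S + 1) G))
        {U | S < 64 ∨ ∃ (k : ℕ) (ch : Fin (k + 1) → Literature.MathematicalPhysics.QuantumFieldTheory.Plaquette 4 (2 * S + 1)),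
          (∀ i, a ≤ (r.N : ℝ) - (r.ρ (Literature.MathematicalPhysics.QuantumFieldTheory.plaquetteHolonomy U
            (ch i).1 (ch i).2.1.1 (ch i).2.1.2)).trace.re) ∧
          (∀ i : Fin k, (Finset.univ.sup fun j : Fin 4 => (((ch i.castSucc).1 j - (ch i.succ).1 j).valMinAbs).natAbs) ≤ 3) ∧
          S ≤ 16 * (Finset.univ.sup fun j : Fin 4 => (((ch 0).1 j - (ch (Fin.last k)).1 j).valMinAbs).natAbs)} ≤
        ENNReal.ofReal (C * Real.exp (-(c * S))) := by
  classical
  -- large-field sparseness on the odd torus, and the per-plaquette ratio `q = e^{-c₀ β}` with `14406 q ≤ e^{-2}`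
  obtain ⟨c₀, b₀, hc₀, hLFS⟩ := largeFieldSparse_explicit G r a ha
  refine ⟨max b₀ ((2 + Real.log 14406) / c₀), fun β hβ => ?_⟩
  have hb₀ : b₀ ≤ β := le_trans (le_max_left _ _) hβ
  set q : ℝ := Real.exp (-(c₀ * β)) with hqdef
  have hq : 14406 * q ≤ Real.exp (-2) := by
    have h0 : 2 + Real.log 14406 ≤ β * c₀ := (div_le_iff₀ hc₀).1 (le_trans (le_max_right _ _) hβ)
    have h2 := Real.exp_le_exp.2 (show Real.log 14406 + -(c₀ * β) ≤ -2 by linarith)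
    rwa [Real.exp_add, Real.exp_log (by norm_num : (0 : ℝ) < 14406)] at h2
  refine ⟨1 / 48, by norm_num, 12 * q * (24 * 96 ^ 4 * Real.exp 2) + Real.exp 2, by positivity, fun S => ?_⟩
  set μ : Measure (GaugeConfig 4 (2 * S + 1) G) := wilsonMeasure r.ρ β with hμ
  haveI : IsProbabilityMeasure μ := isProbabilityMeasure_wilsonMeasure (d := 4) (L := 2 * S + 1) r.ρ r.continuous β
  have hextra : 0 ≤ 12 * q * (24 * 96 ^ 4 * Real.exp 2) * Real.exp (-(1 / 48 * (S : ℝ))) := by positivity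
  -- the small tori `S < 64`: mass `≤ 1 ≤ e² e^{-S/48}`
  by_cases hS : S < 64
  · refine prob_le_one.trans ?_
    rw [← ENNReal.ofReal_one]
    refine ENNReal.ofReal_le_ofReal ?_
    have h1 : (1 : ℝ) ≤ Real.exp 2 * Real.exp (-(1 / 48 * (S : ℝ))) := by
      rw [← Real.exp_add]
      refine Real.one_le_exp ?_
      have : (S : ℝ) ≤ 63 := by exact_mod_cast Nat.le_of_lt_succ hS
      linarith
    nlinarith
  -- the large tori `S ≥ 64`: `k₀ = ⌊S/48⌋`, the Finsets of admissible chains of length `k₀ + m + 1`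
  obtain ⟨k₀, hk₀, hk₀'⟩ : ∃ k₀ : ℕ, k₀ = S / 48 ∧ S ≤ 48 * k₀ + 47 := ⟨S / 48, rfl, by omega⟩
  choose T hTcard hTmem using fun m : ℕ =>
    torus_exists_chainFinset (2 * S + 1) (Finset.univ : Finset (Plaquette 4 (2 * S + 1))) (k₀ + m)
  -- the events "the injective chain `c` is entirely bad" and their large-field bound
  let E : (m : ℕ) → (Fin (k₀ + m + 1) → Plaquette 4 (2 * S + 1)) → Set (GaugeConfig 4 (2 * S + 1) G) := fun m c =>
    {U | Function.Injective c ∧ ∀ i, a ≤ (r.N : ℝ) - (r.ρ (plaquetteHolonomy U (c i).1 (c i).2.1.1 (c i).2.1.2)).trace.re}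
  have hE : ∀ (m : ℕ) (c : Fin (k₀ + m + 1) → Plaquette 4 (2 * S + 1)), μ (E m c) ≤ ENNReal.ofReal (q ^ (k₀ + m + 1)) := by
    intro m c
    by_cases h : Function.Injective c
    · have hX : (Finset.univ.image c).card = k₀ + m + 1 := by
        rw [Finset.card_image_of_injective _ h, Finset.card_univ, Fintype.card_fin]
      have hsub : E m c ⊆ {U | ∀ p ∈ Finset.univ.image c,
          a ≤ (r.N : ℝ) - (r.ρ (plaquetteHolonomy U p.1 p.2.1.1 p.2.1.2)).trace.re} := by
        intro U hU p hp
        obtain ⟨i, -, rfl⟩ := Finset.mem_image.1 hp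
        exact hU.2 i
      have hb := hLFS β hb₀ S (by omega) (Finset.univ.image c)
      rw [hX] at hb
      refine (measure_mono hsub).trans (hb.trans_eq ?_)
      rw [hqdef, ← Real.exp_nat_mul]
      congr 2
      push_cast
      ring
    · rw [Set.eq_empty_of_forall_notMem fun U (hU : U ∈ E m c) => h hU.1, measure_empty]
      exact bot_le
  -- counting
  have hBcard : ((Finset.univ : Finset (Plaquette 4 (2 * S + 1))).card : ℝ) = 6 * (2 * (S : ℝ) + 1) ^ 4 := by
    rw [Finset.card_univ, Fintype.card_prod, Fintype.card_pi, show Fintype.card {p : Fin 4 × Fin 4 // p.1 < p.2} = 6 by decide]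
    simp only [ZMod.card, Finset.prod_const, Finset.card_univ, Fintype.card_fin]
    push_cast
    ring
  set A : ℝ := 6 * (2 * (S : ℝ) + 1) ^ 4 * q with hA
  have hA0 : 0 ≤ A := by rw [hA]; positivity
  have hcard : ∀ m : ℕ, ((T m).card : ENNReal) * ENNReal.ofReal (q ^ (k₀ + m + 1)) ≤ ENNReal.ofReal (A * Real.exp (-2) ^ (k₀ + m)) := by
    intro m
    rw [← ENNReal.ofReal_natCast, ← ENNReal.ofReal_mul (by positivity)]
    refine ENNReal.ofReal_le_ofReal ?_
    have hc : ((T m).card : ℝ) ≤ 6 * (2 * (S : ℝ) + 1) ^ 4 * 14406 ^ (k₀ + m) := by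
      rw [← hBcard]
      exact_mod_cast hTcard m
    calc ((T m).card : ℝ) * q ^ (k₀ + m + 1) ≤ 6 * (2 * (S : ℝ) + 1) ^ 4 * 14406 ^ (k₀ + m) * q ^ (k₀ + m + 1) := by gcongr
      _ = 6 * (2 * (S : ℝ) + 1) ^ 4 * q * (14406 * q) ^ (k₀ + m) := by ring
      _ ≤ 6 * (2 * (S : ℝ) + 1) ^ 4 * q * Real.exp (-2) ^ (k₀ + m) := by gcongr
      _ = A * Real.exp (-2) ^ (k₀ + m) := by rw [hA]
  -- summation
  have hr0 : 0 ≤ Real.exp (-2) := (Real.exp_pos _).le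
  have hr1 : Real.exp (-2) < 1 := Real.exp_lt_one_iff.2 (by norm_num)
  have hsum : HasSum (fun m : ℕ => A * Real.exp (-2) ^ (k₀ + m)) (A * Real.exp (-2) ^ k₀ * (1 - Real.exp (-2))⁻¹) := by
    rw [show (fun m : ℕ => A * Real.exp (-2) ^ (k₀ + m)) = fun m => A * Real.exp (-2) ^ k₀ * Real.exp (-2) ^ m from
      funext fun m => by ring]
    exact (hasSum_geometric_of_lt_one hr0 hr1).mul_left _
  have hμB : μ (⋃ m : ℕ, ⋃ c ∈ T m, E m c) ≤ ENNReal.ofReal (A * Real.exp (-2) ^ k₀ * (1 - Real.exp (-2))⁻¹) :=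
    calc μ (⋃ m : ℕ, ⋃ c ∈ T m, E m c) ≤ ∑' m, μ (⋃ c ∈ T m, E m c) := measure_iUnion_le _
      _ ≤ ∑' m, ∑ c ∈ T m, μ (E m c) := ENNReal.tsum_le_tsum fun m => measure_biUnion_finset_le _ _
      _ ≤ ∑' m, ∑ c ∈ T m, ENNReal.ofReal (q ^ (k₀ + m + 1)) := ENNReal.tsum_le_tsum fun m => Finset.sum_le_sum fun c _ => hE m c
      _ = ∑' m, ((T m).card : ENNReal) * ENNReal.ofReal (q ^ (k₀ + m + 1)) := by simp only [Finset.sum_const, nsmul_eq_mul]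
      _ ≤ ∑' m, ENNReal.ofReal (A * Real.exp (-2) ^ (k₀ + m)) := ENNReal.tsum_le_tsum fun m => hcard m
      _ = ENNReal.ofReal (A * Real.exp (-2) ^ k₀ * (1 - Real.exp (-2))⁻¹) := by
        rw [← ENNReal.ofReal_tsum_of_nonneg (fun m => mul_nonneg hA0 (pow_nonneg hr0 _)) hsum.summable, hsum.tsum_eq]
  -- arithmetic
  have hfin : A * Real.exp (-2) ^ k₀ * (1 - Real.exp (-2))⁻¹ ≤
      (12 * q * (24 * 96 ^ 4 * Real.exp 2) + Real.exp 2) * Real.exp (-(1 / 48 * (S : ℝ))) := by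
    have he2 : Real.exp (-2) ≤ 1 / 2 := by
      have h1 := Real.add_one_le_exp (2 : ℝ)
      have h2 : Real.exp (-2) * Real.exp 2 = 1 := by rw [← Real.exp_add]; norm_num
      nlinarith [Real.exp_pos (-2 : ℝ)]
    have hinv : (1 - Real.exp (-2))⁻¹ ≤ 2 := inv_le_of_inv_le₀ (by norm_num) (by rw [inv_eq_one_div]; linarith)
    have hgeom : Real.exp (-2) ^ k₀ = Real.exp (-(2 * (k₀ : ℝ))) := by
      rw [← Real.exp_nat_mul]
      congr 1
      ring
    have hpoly := torus_poly_geom_le_exp S k₀ hk₀'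
    have hpos : 0 ≤ Real.exp 2 * Real.exp (-(1 / 48 * (S : ℝ))) := by positivity
    calc A * Real.exp (-2) ^ k₀ * (1 - Real.exp (-2))⁻¹ ≤ A * Real.exp (-2) ^ k₀ * 2 := by gcongr
      _ = 12 * q * (((2 : ℝ) * S + 1) ^ 4 * Real.exp (-(2 * (k₀ : ℝ)))) := by rw [hgeom, hA]; ring
      _ ≤ 12 * q * (24 * 96 ^ 4 * Real.exp 2 * Real.exp (-(1 / 48 * (S : ℝ)))) := by gcongr
      _ ≤ 12 * q * (24 * 96 ^ 4 * Real.exp 2 * Real.exp (-(1 / 48 * (S : ℝ)))) + Real.exp 2 * Real.exp (-(1 / 48 * (S : ℝ))) :=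
        le_add_of_nonneg_right hpos
      _ = (12 * q * (24 * 96 ^ 4 * Real.exp 2) + Real.exp 2) * Real.exp (-(1 / 48 * (S : ℝ))) := by ring
  -- covering of the bad event by the events of injective admissible chains of length `k₀ + m + 1`
  refine (measure_mono fun U hU => ?_).trans (hμB.trans (ENNReal.ofReal_le_ofReal hfin))
  rcases hU with h64 | ⟨k, ch, hbad, hst, hlong⟩
  · exact absurd h64 hS
  obtain ⟨K, c', hinj, hQ, hst', hD⟩ := torus_exists_injective_chain
    (Q := fun p => a ≤ (r.N : ℝ) - (r.ρ (plaquetteHolonomy U p.1 p.2.1.1 p.2.1.2)).trace.re) ch hbad hst le_rfl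
  obtain ⟨m, rfl⟩ := Nat.exists_eq_add_of_le (show k₀ ≤ K by omega)
  exact Set.mem_iUnion.2 ⟨m, Set.mem_iUnion₂.2 ⟨c', hTmem m c' (Finset.mem_univ _) hst', ⟨hinj, hQ⟩⟩⟩

/-- **The bad event of the sector interface is exponentially rare under the cover theory `(H, r ∘ π)` at large `β`**
(helper toward stub STRUCT of line `twist-equipartition-blindness`, crux stmt-QuantumFields-16405; binder block of
`stub_sectorStructure`, event of interface clause X0 verbatim, so that the rarity conjunct of STRUCT follows by rewriting
`(cls S)⁻¹' {none}` through X0 for ANY labelling satisfying X0). The event depends on `V` only through `π ∘ V`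
(`corrPullback_plaquetteHolonomy_comp`), `(π ∘ ·)_* μ̃ = μ` (`map_wilsonMeasure_comp_of_surjective`; `G` is second countable
through the faithful `r`), and `torusBadEventRare_base` bounds the `(G, r)`-mass. The hypotheses on `H`, `ker π`, `ρH` are
not used. -/
theorem torusBadEventRare : ∀ (G : Type) [Group G] [TopologicalSpace G] [IsTopologicalGroup G] [CompactSpace G] [MeasurableSpace G] [BorelSpace
    G], Literature.MathematicalPhysics.QuantumFieldTheory.IsCompactSimpleLieGroup G → ∀ (H : Type) [Group H]
    [TopologicalSpace H] [IsTopologicalGroup H] [CompactSpace H] [MeasurableSpace H] [BorelSpace H],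
    Literature.MathematicalPhysics.QuantumFieldTheory.IsCompactSimpleLieGroup H → SimplyConnectedSpace H → ∀ (π : H →*
    G), Continuous π → Function.Surjective π → π.ker ≤ Subgroup.center H → (π.ker : Set H).Finite → π.ker ≠ ⊥ → ∀ (ρH
    : Literature.MathematicalPhysics.QuantumFieldTheory.LatticeRep H) (r :
    Literature.MathematicalPhysics.QuantumFieldTheory.LatticeRep G), ∀ a : ℝ, 0 < a → ∃ β_c : ℝ, ∀ β : ℝ, β_c ≤ β →
    ∃ c : ℝ, 0 < c ∧ ∃ C : ℝ, ∀ S : ℕ, ((Literature.MathematicalPhysics.QuantumFieldTheory.wilsonMeasure (r.ρ.comp π) β :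
    MeasureTheory.Measure (Literature.MathematicalPhysics.QuantumFieldTheory.GaugeConfig 4 (2 * S + 1) H)) {V |
    (S < 64 ∨ ∃ (k : ℕ) (ch : Fin (k + 1) → Literature.MathematicalPhysics.QuantumFieldTheory.Plaquette 4 (2 * S +
    1)), (∀ i, a ≤ (r.N : ℝ) - ((r.ρ.comp π) (Literature.MathematicalPhysics.QuantumFieldTheory.plaquetteHolonomy V
    (ch i).1 (ch i).2.1.1 (ch i).2.1.2)).trace.re) ∧ (∀ i : Fin k, (Finset.univ.sup fun j : Fin 4 => (((ch
    i.castSucc).1 j - (ch i.succ).1 j).valMinAbs).natAbs) ≤ 3) ∧ S ≤ 16 * (Finset.univ.sup fun j : Fin 4 => (((ch 0).1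
    j - (ch (Fin.last k)).1 j).valMinAbs).natAbs))}).toReal ≤ C * Real.exp (-(c * S)) := by
  intro G _ _ _ _ _ _ _hG H _ _ _ _ _ _ _hH _hsc π hπ hsurj _hker _hfin _hnt _ρH r a ha
  haveI : SecondCountableTopology G := (r.continuous.isClosedEmbedding r.injective).isEmbedding.secondCountableTopology
  obtain ⟨β_c, hβ_c⟩ := torusBadEventRare_base G r a ha
  refine ⟨β_c, fun β hβ => ?_⟩
  obtain ⟨c, hc, C, hC0, hS⟩ := hβ_c β hβ
  refine ⟨c, hc, C, fun S => ?_⟩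
  -- `(π ∘ ·)_* μ̃ = μ`, so `μ̃ (Φ ⁻¹' s) ≤ μ s` for every set `s`
  have key : ∀ s : Set (GaugeConfig 4 (2 * S + 1) G),
      wilsonMeasure (r.ρ.comp π) β ((fun (V : GaugeConfig 4 (2 * S + 1) H) (e : Edge 4 (2 * S + 1)) => π (V e)) ⁻¹' s) ≤
        (wilsonMeasure r.ρ β : Measure (GaugeConfig 4 (2 * S + 1) G)) s := fun s =>
    (Measure.le_map_apply (corrPullback_measurable_comp (d := 4) (L := 2 * S + 1) π hπ).aemeasurable s).trans_eq
      (by rw [map_wilsonMeasure_comp_of_surjective (d := 4) (L := 2 * S + 1) π hπ hsurj r.ρ r.continuous β])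
  -- the event is the preimage of the `G`-event under `V ↦ π ∘ V`
  refine ENNReal.toReal_le_of_le_ofReal (by positivity) (((measure_mono fun V hV => ?_).trans (key _)).trans (hS S))
  simp only [Set.mem_preimage, Set.mem_setOf_eq, corrPullback_plaquetteHolonomy_comp]
  exact hV

end Summit.QuantumFields.YangMills.Theorems.NonSimplyConnectedLatticeGap

end
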